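import Summits.AnomalousDissipation.AnomalousDissipation.Theorems.BaireTransferRobustLoudUpgradeStubLsFamilyB
import Literature.Analysis.FluidPDE.SteadyNSLatticePersistenceDrift
import Literature.Analysis.FunctionSpaces.TorusFourierModes

/-!
# Stub `stub_unfoldingPersist` of the line `malkin-cone-group-orbits` (crux stmt-AnomalousDissipation-1144, companion c5
# "the intrinsic unfolding"), part A: the border field, Parseval with a zero mode, drifted synthesis

Helper layer (registered part stub `unfoldingPersist_partA`, the conjunction of §3 and §4 below) for the registered stub
`stub_unfoldingPersist`, assembled in `…StubUnfoldingPersist.lean`.  Setting of that stub:  Let `u₀` be a classical steady state of `NS_ν(f_c)`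
(`ν > 0`, ANY spatial mean `m = ⨍u₀`) whose classical mean-zero kernel of the linearisation `L(ν,u₀)` lies on the complex
line of a smooth divergence-free mean-zero real field `v`, and let the INTRINSIC border field
`h = αΔu₀ + ∑ᵢ dirᵢ ∂ᵢu₀` (`α ∈ ℝ`, `dir ∈ ℤ³`) be first-order visible, `h ∉ range L(ν,u₀)`.  Writing `u = m + w`, the
steady states of mean `m + r·dir` at viscosity `ν − rα` are the zeros of the DRIFTED steady lattice map
`N(x, r) = 4π²(ν − rα) x + D_m x + r D_dir x + B(x,x) − F c'` on the state space `W` of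
`Literature/Analysis/FluidPDE/SteadyNSLatticePersistence(Drift).lean` (`D_M` the compact drift multiplier
`x̌(k) ↦ 2πi (k·M) x̌(k)`), and `∂N/∂r (x₀, 0) = D_dir x₀ − 4π²α x₀` is the coefficient vector of `h`.  Hence the
abstract persistence lemma `Literature.Analysis.Calculus.bordered_unfolding_persistence` (bordered implicit function
theorem with a state-dependent border: compact perturbation of `4π²ν·1`, kernel inside `ℝ·g`, border outside the
range) solves `N(x, r) = F c'` for every `c'` near `c` with `(x, r) → (x₀, 0)`; lattice regularity
(`SteadyLatticeDrift.rapidDecay_of_perturbed_eq`) and synthesis (`SteadyLatticeDrift.steadyState_of_fourier'`) turn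
`(x, r)` into a classical steady state `u'` of `NS_{ν − rα}(f_{c'})` of mean `m + r·dir`, and Parseval
(`h1_le_of_coeff_single`) bounds `∫‖u' − u₀‖² + ‖∇(u' − u₀)‖₂²` by `(1 + 4π²)‖x − x₀‖² + r²|dir|²`.
Pure proof file.  References: Temam 1979 Ch. II §1; Chow–Hale 1982 §2.4; Kielhöfer 2012 §I.2; the route file (item 1144).
-/

-- `Summit.<Summit>.<Problem>` is the tree's mandated summit-side namespace (CONVENTIONS §2); for this
-- single-conjunct summit the two coincide, so the duplicate is deliberate.
set_option linter.dupNamespace false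

noncomputable section

open scoped BigOperators Topology ENNReal NNReal InnerProductSpace ComplexConjugate
open Filter Set Function TopologicalSpace MeasureTheory UnitAddTorus

namespace Summit.AnomalousDissipation.AnomalousDissipation.Theorems.RobustLoudUpgrade.Unfolding

open Literature.Analysis.FunctionSpaces Literature.Analysis.FunctionSpaces.Torus
open Literature.Analysis.FunctionSpaces.EuclideanSpace
open Literature.Analysis.FluidPDE
open Literature.Analysis.FluidPDE.ScalarFourier
open Literature.Analysis.FluidPDE.SteadyLattice
open Literature.Analysis.FluidPDE.SteadyLatticeDrift
open Literature.Analysis.Calculus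
open Summit.AnomalousDissipation.AnomalousDissipation.Theses.BaireTransfer
open Summit.AnomalousDissipation.AnomalousDissipation.Theorems.RobustLoudUpgrade.SteadyPersist
open Summit.AnomalousDissipation.AnomalousDissipation.Theorems.RobustLoudUpgrade.LsFamily

/-! ## §1 The intrinsic border field `αΔu + dir·∇u`: smoothness and Fourier coefficients -/

section Border

variable {u : UnitAddTorus (Fin 3) → EuclideanSpace ℝ (Fin 3)}

/-- The intrinsic border field `αΔu + ∑ᵢ dirᵢ ∂ᵢu` of a smooth field is smooth. [folklore] -/
theorem isSmooth_border (hu : IsSmooth u) (α : ℝ) (dir : Fin 3 → ℤ) :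
    IsSmooth (fun y => α • laplacian u y + ∑ i, (dir i : ℝ) • Torus.partialDeriv i u y) :=
  (hu.laplacian.const_smul α).add (isSmooth_dirDeriv hu dir)

/-- **Fourier coefficients of the intrinsic border field**:
`𝓕(αΔu + ∑ᵢ dirᵢ ∂ᵢu)(k) = (−4π²α|k|² + 2πi (k·dir)) û(k)`. [folklore] -/
theorem mFourierCoeff_border (hu : IsSmooth u) (α : ℝ) (dir : Fin 3 → ℤ) (k : Fin 3 → ℤ) :
    mFourierCoeff (complexify ∘ fun y => α • laplacian u y + ∑ i, (dir i : ℝ) • Torus.partialDeriv i u y) k =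
      (-(((α * (4 * Real.pi ^ 2 * freqNormSq k) : ℝ)) : ℂ) +
          2 * Real.pi * Complex.I * (∑ i, ((k i : ℤ) : ℂ) * ((dir i : ℤ) : ℂ))) • mFourierCoeff (complexify ∘ u) k := by
  have h1 : IsSmooth (complexify ∘ laplacian u) := hu.laplacian.complexify_comp
  have h2 : IsSmooth (fun y => ∑ i, (dir i : ℝ) • Torus.partialDeriv i u y) := isSmooth_dirDeriv hu dir
  have e : (complexify ∘ fun y => α • laplacian u y + ∑ i, (dir i : ℝ) • Torus.partialDeriv i u y) =
      (α : ℂ) • (complexify ∘ laplacian u) + (complexify ∘ fun y => ∑ i, (dir i : ℝ) • Torus.partialDeriv i u y) := by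
    funext y
    simp only [Function.comp_apply, Pi.add_apply, Pi.smul_apply, map_add, LinearIsometry.map_smul, Complex.coe_smul]
  rw [e, mFourierCoeff_add (h1.integrable.smul (α : ℂ)) h2.complexify_comp.integrable, mFourierCoeff_const_smul,
    mFourierCoeff_complexify_laplacian hu k, mFourierCoeff_dirDeriv hu dir k, add_smul, smul_neg, smul_smul, neg_smul]
  congr 2
  push_cast
  ring

end Border

/-! ## §2 Parseval with a zero mode: the squared `H¹` distance of a state shifted by a constant -/

section Parseval

/-- **Parseval control of the squared `H¹` size of a field whose coefficients are a state plus a zero mode**: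
for smooth `v` with `𝓕(complexify ∘ v) = cf z + δ₀ M`, `∫‖v‖² + ‖∇v‖₂² ≤ (1 + 4π²) ‖z‖² + ‖M‖²` (the zero mode is
invisible to the gradient and orthogonal to the rest). [folklore] -/
theorem h1_le_of_coeff_single {v : UnitAddTorus (Fin 3) → EuclideanSpace ℝ (Fin 3)} (hv : IsSmooth v)
    (z : lp (fun _ : Fin 3 → ℤ => EuclideanSpace ℂ (Fin 3)) 2) (M : EuclideanSpace ℂ (Fin 3))
    (hcoef : mFourierCoeff (complexify ∘ v) = ((fun mm : Fin 3 → ℤ => (((freqNormSq mm)⁻¹ : ℝ) : ℂ)) • ((z : (Fin 3 →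
        ℤ) → (EuclideanSpace ℂ (Fin 3))) : (Fin 3 → ℤ) → EuclideanSpace ℂ (Fin 3))) +
        (Pi.single (0 : Fin 3 → ℤ) M : (Fin 3 → ℤ) → EuclideanSpace ℂ (Fin 3))) :
    (∫ x, ‖v x‖ ^ 2) + gradNormSq v ≤ (1 + 4 * Real.pi ^ 2) * ‖z‖ ^ 2 + ‖M‖ ^ 2 := by
  -- pointwise: the two summands have disjoint supports
  have hpt : ∀ k, ‖((((fun mm : Fin 3 → ℤ => (((freqNormSq mm)⁻¹ : ℝ) : ℂ)) • ((z : (Fin 3 → ℤ) → (EuclideanSpace ℂ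
      (Fin 3))) : (Fin 3 → ℤ) → EuclideanSpace ℂ (Fin 3))) +
        (Pi.single (0 : Fin 3 → ℤ) M : (Fin 3 → ℤ) → EuclideanSpace ℂ (Fin 3))) k)‖ ^ 2 =
      ‖(((fun mm : Fin 3 → ℤ => (((freqNormSq mm)⁻¹ : ℝ) : ℂ)) • ((z : (Fin 3 → ℤ) → (EuclideanSpace ℂ (Fin 3))) :
          (Fin 3 → ℤ) → EuclideanSpace ℂ (Fin 3)))) k‖ ^ 2 + ‖(Pi.single (0 : Fin 3 → ℤ) M : (Fin 3 → ℤ) →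
          EuclideanSpace ℂ (Fin 3)) k‖ ^ 2 := by
    intro k
    by_cases hk : k = 0
    · subst hk
      rw [Pi.add_apply, cf_zero, zero_add, norm_zero]
      ring
    · rw [Pi.add_apply, Pi.single_eq_of_ne hk, add_zero, norm_zero]
      ring
  have hsingle : ∑' k, ‖(Pi.single (0 : Fin 3 → ℤ) M : (Fin 3 → ℤ) → EuclideanSpace ℂ (Fin 3)) k‖ ^ 2 = ‖M‖ ^ 2 := by
    rw [tsum_eq_single 0 (fun k hk => by rw [Pi.single_eq_of_ne hk, norm_zero]; ring)]
    rw [Pi.single_eq_same]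
  -- the `L²` part
  have hL2 : (∫ x, ‖v x‖ ^ 2) ≤ ‖z‖ ^ 2 + ‖M‖ ^ 2 := by
    rw [integral_norm_sq_eq_tsum (hv.memLp 2), hcoef, l2_norm_sq_eq_tsum]
    have hs := (l2_hasSum_norm_sq z).summable
    have hle : ∀ k, ‖(((fun mm : Fin 3 → ℤ => (((freqNormSq mm)⁻¹ : ℝ) : ℂ)) • ((z : (Fin 3 → ℤ) → (EuclideanSpace ℂ
        (Fin 3))) : (Fin 3 → ℤ) → EuclideanSpace ℂ (Fin 3)))) k‖ ^ 2 ≤ ‖(z : (Fin 3 → ℤ) → (EuclideanSpace ℂ (Fin 3)))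
        k‖ ^ 2 := fun k =>
      pow_le_pow_left₀ (norm_nonneg _) (norm_cf_le _ k) 2
    have hs' : Summable fun k => ‖(((fun mm : Fin 3 → ℤ => (((freqNormSq mm)⁻¹ : ℝ) : ℂ)) • ((z : (Fin 3 → ℤ) →
        (EuclideanSpace ℂ (Fin 3))) : (Fin 3 → ℤ) → EuclideanSpace ℂ (Fin 3)))) k‖ ^ 2 :=
      Summable.of_nonneg_of_le (fun k => sq_nonneg _) hle hs
    have hss : Summable fun k => ‖(Pi.single (0 : Fin 3 → ℤ) M : (Fin 3 → ℤ) → EuclideanSpace ℂ (Fin 3)) k‖ ^ 2 :=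
      summable_of_ne_finset_zero (s := {0}) (fun k hk => by
        rw [Finset.mem_singleton] at hk
        rw [Pi.single_eq_of_ne hk, norm_zero]; ring)
    rw [tsum_congr hpt, hs'.tsum_add hss, hsingle]
    exact add_le_add (Summable.tsum_le_tsum hle hs' hs) le_rfl
  -- the gradient part: the zero mode carries the weight `|0|² = 0`
  have hG : gradNormSq v ≤ 4 * Real.pi ^ 2 * ‖z‖ ^ 2 := by
    have h := tsum_freqNormSq_mul_enorm_sq_mFourierCoeff_complexify hv
    rw [hcoef] at h
    have hptG : ∀ k, ENNReal.ofReal (freqNormSq k) * ‖((((fun mm : Fin 3 → ℤ => (((freqNormSq mm)⁻¹ : ℝ) : ℂ)) • ((z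
        : (Fin 3 → ℤ) → (EuclideanSpace ℂ (Fin 3))) : (Fin 3 → ℤ) → EuclideanSpace ℂ (Fin 3))) +
          (Pi.single (0 : Fin 3 → ℤ) M : (Fin 3 → ℤ) → EuclideanSpace ℂ (Fin 3))) k)‖ₑ ^ 2 =
        ENNReal.ofReal (freqNormSq k) * ‖(((fun mm : Fin 3 → ℤ => (((freqNormSq mm)⁻¹ : ℝ) : ℂ)) • ((z : (Fin 3 →
          ℤ) → (EuclideanSpace ℂ (Fin 3))) : (Fin 3 → ℤ) → EuclideanSpace ℂ (Fin 3)))) k‖ₑ ^ 2 := by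
      intro k
      by_cases hk : k = 0
      · subst hk
        rw [freqNormSq_zero, ENNReal.ofReal_zero, zero_mul, zero_mul]
      · rw [Pi.add_apply, Pi.single_eq_of_ne hk, add_zero]
    have hle : ∑' k, ENNReal.ofReal (freqNormSq k) * ‖((((fun mm : Fin 3 → ℤ => (((freqNormSq mm)⁻¹ : ℝ) : ℂ)) • ((z
        : (Fin 3 → ℤ) → (EuclideanSpace ℂ (Fin 3))) : (Fin 3 → ℤ) → EuclideanSpace ℂ (Fin 3))) +
          (Pi.single (0 : Fin 3 → ℤ) M : (Fin 3 → ℤ) → EuclideanSpace ℂ (Fin 3))) k)‖ₑ ^ 2 ≤ ‖z‖ₑ ^ 2 := by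
      rw [tsum_congr hptG, l2_enorm_sq_eq_tsum]
      exact ENNReal.tsum_le_tsum fun k => freq_mul_enorm_cf_sq_le _ k
    rw [h, ← ofReal_norm, ← ENNReal.ofReal_pow (norm_nonneg _), ENNReal.ofReal_le_ofReal_iff (sq_nonneg _)] at hle
    have hpi : (0 : ℝ) < 4 * Real.pi ^ 2 := by positivity
    rw [inv_mul_le_iff₀ hpi] at hle
    exact hle
  nlinarith

end Parseval

/-! ## §3 Drifted synthesis: a lattice solution with a prescribed zero mode is a classical steady state -/

section Synthesis

variable {W : Submodule ℝ (lp (fun _ : Fin 3 → ℤ => EuclideanSpace ℂ (Fin 3)) 2)} (hW : ∀ x : (lp (fun _ : Fin 3 →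
    ℤ => EuclideanSpace ℂ (Fin 3)) 2), x ∈ W ↔ (((x : (Fin 3 → ℤ) → (EuclideanSpace ℂ (Fin 3))) : (Fin 3 → ℤ) →
    EuclideanSpace ℂ (Fin 3)) 0 = 0 ∧ (∀ kk : Fin 3 → ℤ, (∑ jj : Fin 3, ((kk jj : ℤ) : ℂ) * (((x : (Fin 3 → ℤ) →
    (EuclideanSpace ℂ (Fin 3))) : (Fin 3 → ℤ) → EuclideanSpace ℂ (Fin 3)) kk) jj) = 0) ∧ IsConjSymm ((x : (Fin 3 → ℤ)
    → (EuclideanSpace ℂ (Fin 3))) : (Fin 3 → ℤ) → EuclideanSpace ℂ (Fin 3))))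
include hW

variable {S : Finset (Fin 3 → ℤ)}

/-- **Drifted synthesis.**  A state `x ∈ W` solving the drifted steady lattice equation of the force `f_{c'}` at viscosity
`ν' > 0` with a real zero mode `M'` — `4π²ν' x(k) + 2πi (k·M') x̌(k) + Π N(x̌, x̌)(k) = 𝓕(f_{c'})(k)` — synthesises a
classical steady state `u'` of `NS_{ν'}(f_{c'})` with `𝓕 u' = x̌ + δ₀ M'` (so `⨍ u' = Re M'`): lattice regularity
`SteadyLatticeDrift.rapidDecay_of_perturbed_eq` with `a = δ₀ M'`, then `SteadyLatticeDrift.steadyState_of_fourier'`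
for the full family. [folklore] -/
theorem exists_steadyState_of_drifted_eq {ν' : ℝ} (hν' : 0 < ν') (c' : Coeff S) (x : W) {M' : EuclideanSpace ℂ (Fin 3)}
    (hM' : conjVec M' = M')
    (hxeq : ∀ k : (Fin 3 → ℤ), (((4 * Real.pi ^ 2 * ν' : ℝ)) : ℂ) • ((x : (lp (fun _ : Fin 3 → ℤ => EuclideanSpace ℂ
      (Fin 3)) 2)) : (Fin 3 → ℤ) → (EuclideanSpace ℂ (Fin 3))) k +
      (2 * Real.pi * Complex.I * (∑ jj : Fin 3, ((k jj : ℤ) : ℂ) * M' jj)) • (((fun mm : Fin 3 → ℤ => (((freqNormSq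
          mm)⁻¹ : ℝ) : ℂ)) • (((x : (lp (fun _ : Fin 3 → ℤ => EuclideanSpace ℂ (Fin 3)) 2)) : (Fin 3 → ℤ) →
          (EuclideanSpace ℂ (Fin 3))) : (Fin 3 → ℤ) → EuclideanSpace ℂ (Fin 3)))) k +
      Torus.lerayCoeff k ((WithLp.toLp 2 (fun pp : Fin 3 => transportSym (fun jj mm => (((fun mm : Fin 3 →
          ℤ => (((freqNormSq mm)⁻¹ : ℝ) : ℂ)) • (((x : (lp (fun _ : Fin 3 → ℤ => EuclideanSpace ℂ (Fin 3)) 2)) : (Fin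
          3 → ℤ) → (EuclideanSpace ℂ (Fin 3))) : (Fin 3 → ℤ) → EuclideanSpace ℂ (Fin 3)))) mm jj) (fun mm => (((fun
          mm : Fin 3 → ℤ => (((freqNormSq mm)⁻¹ : ℝ) : ℂ)) • (((x : (lp (fun _ : Fin 3 → ℤ => EuclideanSpace ℂ (Fin
          3)) 2)) : (Fin 3 → ℤ) → (EuclideanSpace ℂ (Fin 3))) : (Fin 3 → ℤ) → EuclideanSpace ℂ (Fin 3)))) mm pp) k) :
          EuclideanSpace ℂ (Fin 3))) =
      mFourierCoeff (complexify ∘ force S c') k) :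
    ∃ (u' : UnitAddTorus (Fin 3) → EuclideanSpace ℝ (Fin 3)) (p' : UnitAddTorus (Fin 3) → ℝ),
      Torus.IsSteadyNSState ν' (force S c') u' p' ∧ IsSmooth u' ∧
        mFourierCoeff (complexify ∘ u') = ((fun mm : Fin 3 → ℤ => (((freqNormSq mm)⁻¹ : ℝ) : ℂ)) • (((x : (lp (fun _ :
          Fin 3 → ℤ => EuclideanSpace ℂ (Fin 3)) 2)) : (Fin 3 → ℤ) → (EuclideanSpace ℂ (Fin 3))) : (Fin 3 → ℤ) →
          EuclideanSpace ℂ (Fin 3))) + (Pi.single (0 : (Fin 3 → ℤ)) M' : (Fin 3 → ℤ) → (EuclideanSpace ℂ (Fin 3))) := by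
  have hxr : RapidDecay (((fun mm : Fin 3 → ℤ => (((freqNormSq mm)⁻¹ : ℝ) : ℂ)) • (((x : (lp (fun _ : Fin 3 →
      ℤ => EuclideanSpace ℂ (Fin 3)) 2)) : (Fin 3 → ℤ) → (EuclideanSpace ℂ (Fin 3))) : (Fin 3 → ℤ) → EuclideanSpace ℂ
      (Fin 3)))) :=
    rapidDecay_of_perturbed_eq hν' (rapidDecay_single M') (single_transversal M') (x : (lp (fun _ : Fin 3 →
        ℤ => EuclideanSpace ℂ (Fin 3)) 2)) (W_trans hW x)
      (fun s => tsum_weight_mul_enorm_ne_top_of_rapidDecay (rapidDecay_forceCoeff c') s)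
      (fun k => by
        rw [leray_nl_linearised_single M' (W_trans hW x) k]
        exact hxeq k)
  -- the full family: zero mode `M'` restored
  set c₁ : (Fin 3 → ℤ) → (EuclideanSpace ℂ (Fin 3)) := ((fun mm : Fin 3 → ℤ => (((freqNormSq mm)⁻¹ : ℝ) : ℂ)) • (((x :
      (lp (fun _ : Fin 3 → ℤ => EuclideanSpace ℂ (Fin 3)) 2)) : (Fin 3 → ℤ) → (EuclideanSpace ℂ (Fin 3))) : (Fin 3 →
      ℤ) → EuclideanSpace ℂ (Fin 3))) + (Pi.single (0 : (Fin 3 → ℤ)) M' : (Fin 3 → ℤ) → (EuclideanSpace ℂ (Fin 3)))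
      with hc₁
  have hc₁r : RapidDecay c₁ := hxr.add (rapidDecay_single _)
  have hc₁cs : IsConjSymm c₁ := (isConjSymm_cf (W_conj hW x)).add (isConjSymm_single hM')
  have hc₁t : ∀ k : (Fin 3 → ℤ), (∑ jj : Fin 3, ((k jj : ℤ) : ℂ) * (c₁ k) jj) = 0 := fun k => by
    rw [hc₁, Pi.add_apply, kdot_add, cf_transversal (W_trans hW x) k, single_transversal, add_zero]
  have hupd : Function.update c₁ 0 0 = ((fun mm : Fin 3 → ℤ => (((freqNormSq mm)⁻¹ : ℝ) : ℂ)) • (((x : (lp (fun _ :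
      Fin 3 → ℤ => EuclideanSpace ℂ (Fin 3)) 2)) : (Fin 3 → ℤ) → (EuclideanSpace ℂ (Fin 3))) : (Fin 3 → ℤ) →
      EuclideanSpace ℂ (Fin 3))) := update_add_single_of_zero (cf_zero _) _
  have hc₁0 : c₁ 0 = M' := add_single_apply_zero (cf_zero _) _
  have heq₁ : ∀ k : (Fin 3 → ℤ), (((ν' * (4 * Real.pi ^ 2 * freqNormSq k)) : ℝ) : ℂ) • c₁ k + Torus.lerayCoeff k
      ((WithLp.toLp 2 (fun pp : Fin 3 => transportSym (fun jj mm => c₁ mm jj) (fun mm => c₁ mm pp) k) : EuclideanSpace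
      ℂ (Fin 3))) =
      mFourierCoeff (complexify ∘ force S c') k := by
    intro k
    rw [leray_nl_self_update hc₁r hc₁t k, ← weight_smul_update c₁ k, hupd, hc₁0, ← hxeq k,
      smul_eq_weight_smul_cf (W_zero hW x) k]
    abel
  obtain ⟨u', p', hst', hu', hû'⟩ := steadyState_of_fourier' (isSmooth_force' c') (isDivFree_force' c')
    (hasZeroMean_force' c') hc₁r hc₁cs hc₁t heq₁
  exact ⟨u', p', hst', hu', by rw [hû']⟩

end Synthesis

/-! ## §4 The squared `H¹` distance of two states with different means -/

section Distance

variable {W : Submodule ℝ (lp (fun _ : Fin 3 → ℤ => EuclideanSpace ℂ (Fin 3)) 2)}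

/-- **Squared `H¹` distance of two classical states from their lattice data**: if `𝓕u' = x̌ + δ₀ M'` and
`𝓕u₀ = x̌₀ + δ₀ M₀`, then `∫‖u' − u₀‖² + ‖∇(u' − u₀)‖₂² ≤ (1 + 4π²)‖x − x₀‖² + ‖M' − M₀‖²`. [folklore] -/
theorem h1DistSq_le_of_states {u' u₀ : UnitAddTorus (Fin 3) → EuclideanSpace ℝ (Fin 3)} (hu' : IsSmooth u')
    (hu₀ : IsSmooth u₀) (x x₀ : W) (M' M₀ : EuclideanSpace ℂ (Fin 3))
    (hx : mFourierCoeff (complexify ∘ u') = ((fun mm : Fin 3 → ℤ => (((freqNormSq mm)⁻¹ : ℝ) : ℂ)) • (((x : (lp (fun _ :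
      Fin 3 → ℤ => EuclideanSpace ℂ (Fin 3)) 2)) : (Fin 3 → ℤ) → (EuclideanSpace ℂ (Fin 3))) : (Fin 3 → ℤ) →
      EuclideanSpace ℂ (Fin 3))) + (Pi.single (0 : (Fin 3 → ℤ)) M' : (Fin 3 → ℤ) → (EuclideanSpace ℂ (Fin 3))))
    (hx₀ : mFourierCoeff (complexify ∘ u₀) = ((fun mm : Fin 3 → ℤ => (((freqNormSq mm)⁻¹ : ℝ) : ℂ)) • (((x₀ : (lp (fun _
      : Fin 3 → ℤ => EuclideanSpace ℂ (Fin 3)) 2)) : (Fin 3 → ℤ) → (EuclideanSpace ℂ (Fin 3))) : (Fin 3 → ℤ) →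
      EuclideanSpace ℂ (Fin 3))) + (Pi.single (0 : (Fin 3 → ℤ)) M₀ : (Fin 3 → ℤ) → (EuclideanSpace ℂ (Fin 3)))) :
    h1DistSq u' u₀ ≤ (1 + 4 * Real.pi ^ 2) * ‖x - x₀‖ ^ 2 + ‖M' - M₀‖ ^ 2 := by
  have hvd : IsSmooth (fun y => u' y - u₀ y) := hu'.sub hu₀
  have hcoefv : mFourierCoeff (complexify ∘ fun y => u' y - u₀ y) = ((fun mm : Fin 3 → ℤ => (((freqNormSq mm)⁻¹ : ℝ)
      : ℂ)) • ((((x - x₀ : W) : (lp (fun _ : Fin 3 → ℤ => EuclideanSpace ℂ (Fin 3)) 2)) : (Fin 3 → ℤ) →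
      (EuclideanSpace ℂ (Fin 3))) : (Fin 3 → ℤ) → EuclideanSpace ℂ (Fin 3))) +
      (Pi.single (0 : Fin 3 → ℤ) (M' - M₀) : (Fin 3 → ℤ) → EuclideanSpace ℂ (Fin 3)) := by
    have e : (complexify ∘ fun y => u' y - u₀ y : (UnitAddTorus (Fin 3)) → (EuclideanSpace ℂ (Fin 3))) = (complexify
        ∘ u') - (complexify ∘ u₀) := by
      funext y; simp
    rw [e, coeW_sub]
    funext k
    rw [mFourierCoeff_sub hu'.complexify_comp.integrable hu₀.complexify_comp.integrable, hx, hx₀]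
    by_cases hk : k = 0
    · subst hk
      simp only [Pi.add_apply, cf_zero, Pi.single_eq_same]
      abel
    · simp only [Pi.add_apply, Pi.sub_apply, Pi.smul_apply', smul_sub, Pi.single_eq_of_ne hk]
      abel
  have hH := h1_le_of_coeff_single hvd ((x - x₀ : W) : (lp (fun _ : Fin 3 → ℤ => EuclideanSpace ℂ (Fin 3)) 2))
    (M' - M₀) hcoefv
  rw [norm_coeW] at hH
  exact hH

end Distance


/-! ## §5 The registered part stub -/

section PartStub

/-- **Registered part stub `unfoldingPersist_partA`** (`ledger workitem stub-add stmt-AnomalousDissipation-1144 --name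
unfoldingPersist_partA`): the conjunction of the drifted synthesis (§3) and the lattice `H¹` distance (§4), consumed by the
registered stub `stub_unfoldingPersist`. [folklore] -/
theorem unfoldingPersist_partA : (∀ (W : Submodule ℝ (lp (fun _ : Fin 3 → ℤ => EuclideanSpace ℂ (Fin 3)) 2)), (∀ x : (lp (fun _ : Fin 3 → ℤ => EuclideanSpace ℂ (Fin 3)) 2), x ∈ W ↔ (((x : (Fin 3 → ℤ) → (EuclideanSpace ℂ (Fin 3))) : (Fin 3 → ℤ) → EuclideanSpace ℂ (Fin 3)) 0 = 0 ∧ (∀ kk : Fin 3 → ℤ, (∑ jj : Fin 3, ((kk jj : ℤ) : ℂ) * (((x : (Fin 3 → ℤ) → (EuclideanSpace ℂ (Fin 3))) : (Fin 3 → ℤ) → EuclideanSpace ℂ (Fin 3)) kk) jj) = 0) ∧ IsConjSymm ((x : (Fin 3 → ℤ) → (EuclideanSpace ℂ (Fin 3))) : (Fin 3 → ℤ) → EuclideanSpace ℂ (Fin 3)))) → ∀ (S : Finset (Fin 3 → ℤ)) (ν' : ℝ), 0 < ν' → ∀ (c' : Coeff S) (x : W) (M' : EuclideanSpace ℂ (Fin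 3)), conjVec M' = M' → (∀ k : (Fin 3 → ℤ), (((4 * Real.pi ^ 2 * ν' : ℝ)) : ℂ) • ((x : (lp (fun _ : Fin 3 → ℤ => EuclideanSpace ℂ (Fin 3)) 2)) : (Fin 3 → ℤ) → (EuclideanSpace ℂ (Fin 3))) k + (2 * Real.pi * Complex.I * (∑ jj : Fin 3, ((k jj : ℤ) : ℂ) * M' jj)) • (((fun mm : Fin 3 → ℤ => (((freqNormSq mm)⁻¹ : ℝ) : ℂ)) • (((x : (lp (fun _ : Fin 3 → ℤ => EuclideanSpace ℂ (Fin 3)) 2)) : (Fin 3 → ℤ) → (EuclideanSpace ℂ (Fin 3))) : (Fin 3 → ℤ) → EuclideanSpace ℂ (Fin 3)))) k + Torus.lerayCoeff k ((WithLp.toLp 2 (fun pp : Fin 3 => transportSym (fun jj mm => (((fun mm : Fin 3 → ℤ => (((freqNormSq mm)⁻¹ : ℝ) : ℂ)) • (((x : (lp (fun _ : Fin 3 → ℤ => EuclideanSpace ℂ (Fin 3)) 2)) : (Fin 3 → ℤ) → (EuclideanSpace ℂ (Fin 3))) : (Fin 3 → ℤ) → EuclideanSpace ℂ (Fin 3))))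 mm jj) (fun mm => (((fun mm : Fin 3 → ℤ => (((freqNormSq mm)⁻¹ : ℝ) : ℂ)) • (((x : (lp (fun _ : Fin 3 → ℤ => EuclideanSpace ℂ (Fin 3)) 2)) : (Fin 3 → ℤ) → (EuclideanSpace ℂ (Fin 3))) : (Fin 3 → ℤ) → EuclideanSpace ℂ (Fin 3)))) mm pp) k) : EuclideanSpace ℂ (Fin 3))) = mFourierCoeff (complexify ∘ force S c') k) → ∃ (u' : UnitAddTorus (Fin 3) → EuclideanSpace ℝ (Fin 3)) (p' : UnitAddTorus (Fin 3) → ℝ), Torus.IsSteadyNSState ν' (force S c') u' p' ∧ IsSmooth u' ∧ mFourierCoeff (complexify ∘ u') = ((fun mm : Fin 3 → ℤ => (((freqNormSq mm)⁻¹ : ℝ) : ℂ)) • (((x : (lp (fun _ : Fin 3 → ℤ => EuclideanSpace ℂ (Fin 3)) 2)) : (Fin 3 → ℤ) → (EuclideanSpace ℂ (Fin 3))) : (Fin 3 → ℤ) → EuclideanSpace ℂ (Fin 3))) + (Pi.single (0 : (Fin 3 → ℤ)) M' : (Fin 3 → ℤ) → (EuclideanSpace ℂ (Fin 3)))) ∧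 (∀ (W : Submodule ℝ (lp (fun _ : Fin 3 → ℤ => EuclideanSpace ℂ (Fin 3)) 2)) (u' u₀ : UnitAddTorus (Fin 3) → EuclideanSpace ℝ (Fin 3)), IsSmooth u' → IsSmooth u₀ → ∀ (x x₀ : W) (M' M₀ : EuclideanSpace ℂ (Fin 3)), mFourierCoeff (complexify ∘ u') = ((fun mm : Fin 3 → ℤ => (((freqNormSq mm)⁻¹ : ℝ) : ℂ)) • (((x : (lp (fun _ : Fin 3 → ℤ => EuclideanSpace ℂ (Fin 3)) 2)) : (Fin 3 → ℤ) → (EuclideanSpace ℂ (Fin 3))) : (Fin 3 → ℤ) → EuclideanSpace ℂ (Fin 3))) + (Pi.single (0 : (Fin 3 → ℤ)) M' : (Fin 3 → ℤ) → (EuclideanSpace ℂ (Fin 3))) → mFourierCoeff (complexify ∘ u₀) = ((fun mm : Fin 3 → ℤ => (((freqNormSq mm)⁻¹ : ℝ) : ℂ)) • (((x₀ : (lp (fun _ : Fin 3 → ℤ => EuclideanSpace ℂ (Fin 3)) 2)) : (Fin 3 → ℤ) → (EuclideanSpace ℂ (Fin 3))) : (Fin 3 → ℤ) → EuclideanSpace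 ℂ (Fin 3))) + (Pi.single (0 : (Fin 3 → ℤ)) M₀ : (Fin 3 → ℤ) → (EuclideanSpace ℂ (Fin 3))) → h1DistSq u' u₀ ≤ (1 + 4 * Real.pi ^ 2) * ‖x - x₀‖ ^ 2 + ‖M' - M₀‖ ^ 2) :=
  ⟨fun _ hW _ _ hν' c' x _ hM' hxeq => exists_steadyState_of_drifted_eq hW hν' c' x hM' hxeq,
    fun _ _ _ hu' hu₀ x x₀ M' M₀ hx hx₀ => h1DistSq_le_of_states hu' hu₀ x x₀ M' M₀ hx hx₀⟩

end PartStub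

end Summit.AnomalousDissipation.AnomalousDissipation.Theorems.RobustLoudUpgrade.Unfolding

end
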